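import Summits.Ventures.PercRepro.C041ZonePortCSLemma
import Summits.Ventures.PercRepro.C041ZonePortCSAndCaseII
import Summits.Ventures.PercRepro.C041ZonePortCSAndCaseIV
import Summits.Ventures.PercRepro.C041ZonePortCSAndUnport

/-!
# THEOREM R-CS WITH THE VALIDITY `V_∧`: CONJECTURE (CS) on every zone port problem without an edge between the
terminals (p6, gen 28; mine-3's C-041.md §17 (a) REMARK (3), «not written out» — it goes through verbatim)

The gate induction `cs_induction` of `C041ZonePortCSLemma` with the `V_∧` cases: **`csAnd_of_zonesReached`** and
THE LEMMA `0 ≤ Φ∧ P` re-derived by AM–GM (`phiAnd_nonneg_of_cs`).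
-/

namespace PercRepro

namespace ZonePort

namespace Problem

open Finset CSCount

variable {V E : Type*}

section TheoremRCSAnd

variable [Fintype E] [DecidableEq E] [DecidableEq V]

/-- **THEOREM R-CS (mine-3, C-041.md §17 (a))**: on every zone port problem whose zones are reached from the root
set, CONJECTURE (CS) holds — `(#valid − #Good₁ − #Good₂)₊² ≤ #Good₁ · #Good₂`. -/
theorem csAnd_of_zonesReached (P : Problem V E) (hconn : P.ZonesReached) : P.CSAnd :=
  cs_induction CSAnd (fun _ h => csAnd_of_Z_empty h)
    (fun _ _ hC hsw => csAnd_of_forced_gate hC hsw)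
    (fun _ _ hC _ _ h1 h2 h3 h4 => csAnd_of_twoType_gate hC h1 h2 h3 h4)
    (fun _ _ _ hCe hCf he hf hpe hpf => csAnd_of_pure_gates_mixed hCe hCf he hf hpe hpf)
    (fun _ _ hmem hS hedge h => by
      obtain ⟨e, he⟩ := hedge
      exact csAnd_of_pure₁_gates (fun C hC => (hmem C).1 hC) (fun C hC => (hS C hC).2) (fun C hC => (hS C hC).1) he h)
    (fun P S hmem hS hedge h => by
      obtain ⟨e, he⟩ := hedge
      rw [← csAnd_swap]
      have h' : (P.swap.unport S).CSAnd := by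
        rw [swap_unport]
        exact csAnd_swap.2 h
      exact csAnd_of_pure₁_gates (P := P.swap) (fun C hC => (isGate_swap C).2 ((hmem C).1 hC))
        (fun C hC => (pure₁_swap C).2 (hS C hC).2) (fun C hC => (hS C hC).1) (e := P.swapTerm e) he h')
    _ P rfl hconn

/-- **THEOREM R's LEMMA as the AM–GM corollary of THEOREM R-CS**: `0 ≤ Φ∧ P` (a second proof of `phiAnd_nonneg`). -/
theorem phiAnd_nonneg_of_cs (P : Problem V E) (hconn : P.ZonesReached) : 0 ≤ P.phiAnd :=
  phiAnd_nonneg_of_csAnd (csAnd_of_zonesReached P hconn)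

end TheoremRCSAnd

end Problem

end ZonePort

end PercRepro
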